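import Mathlib
import Summits.Ventures.PercRepro2.CoinTreeCore
import Summits.Ventures.PercRepro2.CoinOrTailKDefs
import Summits.Ventures.PercRepro2.CoinChainOneAwareDarc

/-!
# The pure chain with a HEAD-AWARE non-entry and entry markers: an instantiation
(blind cell PercRepro2, night-2 g20; NIGHT2-DARC.md §60.11)

Seventeen coins on `Fin 11` (s = 0, z = 1, m₁ = 2, m₂ = 3, a' = 4, a = 5, h₁ = 6, h₂ = 7,
h₃ = 8, w = 9, t = 10): the out-tree core `s → z, m₁, m₂`; the OR-vertex `a'` entered from
the entries `m₁, m₂` by sure arcs; `a` from `a'` by one coin; the head `a → h₁ ← m₁`,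
`a → h₂ ← m₂`, `w → h₃ ← m₂`, `a → h₃`, `z → h₃` (the NON-ENTRY `z` HAS a route into the head,
merging with `w`'s and `a`'s), `h_i → t`.  Row 2′DARC at `a → w` for the entry markers
`(m₁, m₂)` for EVERY probability vector with the two entry arcs sure (`darc_oneAware_example`).
-/

namespace Summit.Ventures.PercRepro2.Coin

namespace OneAwareExample

open Classical

/-- The seventeen coins of the example. -/
def arcsA : Fin 17 → Finset (Fin 11 × Fin 11)
  | 0 => {(0, 1)}    -- s → z
  | 1 => {(0, 2)}    -- s → m₁
  | 2 => {(0, 3)}    -- s → m₂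
  | 3 => {(2, 4)}    -- m₁ → a' (sure)
  | 4 => {(3, 4)}    -- m₂ → a' (sure)
  | 5 => {(4, 5)}    -- a' → a (the chain coin)
  | 6 => {(5, 6)}    -- a → h₁
  | 7 => {(2, 6)}    -- m₁ → h₁
  | 8 => {(6, 10)}   -- h₁ → t
  | 9 => {(5, 7)}    -- a → h₂
  | 10 => {(3, 7)}   -- m₂ → h₂
  | 11 => {(7, 10)}  -- h₂ → t
  | 12 => {(9, 8)}   -- w → h₃
  | 13 => {(3, 8)}   -- m₂ → h₃
  | 14 => {(8, 10)}  -- h₃ → t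
  | 15 => {(5, 8)}   -- a → h₃
  | _ => {(1, 8)}    -- z → h₃ (the head-aware non-entry)

/-- The entry coins of `a'`. -/
def c'A : Fin 11 → Fin 17
  | 2 => 3
  | 3 => 4
  | _ => 0

/-- The entry coin of `a`. -/
def cA : Fin 11 → Fin 17
  | 4 => 5
  | _ => 0

/-- The tree coins. -/
def tcA : Fin 11 → Fin 17
  | 1 => 0
  | 2 => 1
  | 3 => 2
  | _ => 0

/-- The parent map (the root `s`). -/
def parA : Fin 11 → Fin 11 := fun _ => 0

/-- The rank. -/
def rkA : Fin 11 → ℕ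
  | 1 => 1
  | 2 => 1
  | 3 => 1
  | _ => 0

/-- Every coin is a single arc. -/
lemma sameEnds_a : SameEnds arcsA := by
  intro e xy hxy x'y' hx'y'
  fin_cases e <;> simp [arcsA] at hxy hx'y' <;> subst hxy <;> subst hx'y' <;>
    exact ⟨Or.inl rfl, Or.inr rfl⟩

set_option maxRecDepth 20000 in
/-- The out-tree core `{z, m₁, m₂}`. -/
lemma treeCore_a : TreeCore arcsA 0 {1, 2, 3} tcA parA rkA where
  tree := by decide
  par_mem := by decide
  rank := by decide
  into_C := by decide
  into_s := by decide
  s_notin := by decide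

set_option maxRecDepth 20000 in
/-- `a' = 4` is an OR-vertex of the core entered from `m₁, m₂`. -/
lemma orTailK'_a : OrTailK arcsA 0 {1, 2, 3} {2, 3} c'A 4 where
  ent_sub := by decide
  s_notin := by decide
  a_notin := by decide
  a_ne_s := by decide
  into_U := by decide
  into_s := by decide
  into_a := by decide
  arcs_c := by decide
  c_inj := by decide

set_option maxRecDepth 20000 in
/-- `a = 5` is an OR-vertex of `U ∪ {a'}` entered from `a'` alone. -/
lemma orTailK_a : OrTailK arcsA 0 (insert 4 {1, 2, 3}) {4} cA 5 where
  ent_sub := by decide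
  s_notin := by decide
  a_notin := by decide
  a_ne_s := by decide
  into_U := by decide
  into_s := by decide
  into_a := by decide
  arcs_c := by decide
  c_inj := by decide

set_option maxRecDepth 20000 in
/-- **Row 2′DARC at `a → w` for the entry markers `(m₁, m₂)` on the seventeen-coin instance with a
HEAD-AWARE non-entry `z`, every probability vector with the two entry arcs sure.** -/
theorem darc_oneAware_example {R : Type*} [Field R] [LinearOrder R] [IsStrictOrderedRing R]
    (pr : Fin 17 → R) (hp : IsProbVec pr) (h3 : pr 3 = 1) (h4 : pr 4 = 1) :
    DARC pr arcsA 0 {10} 2 3 5 9 :=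
  darc_of_pureChainTree_of_oneAware pr hp sameEnds_a orTailK'_a
    (by
      intro r hr
      simp only [Finset.mem_insert, Finset.mem_singleton] at hr
      rcases hr with rfl | rfl
      · exact h3
      · exact h4)
    orTailK_a treeCore_a (by decide) (by decide) (by decide) (by decide) (by decide) (by decide)
    1 (by decide)

end OneAwareExample

end Summit.Ventures.PercRepro2.Coin
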